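import Summits.BirchSwinnertonDyer.BirchSwinnertonDyer.Theorems.KimAtThreeDeepLowerOffStratumSemistable
import Summits.BirchSwinnertonDyer.Rank1Residual.X4.KuriharaLevelLoweringOfMultiplicityOne
import Summits.BirchSwinnertonDyer.Rank1Residual.X4.KuriharaLevelLoweringField
import Literature.NumberTheory.EllipticCurves.HidaFamilyMembersProofs
import HarnessLib

/-!
# Route `KimAtThreeKolyvagin` (rung W2), crux `DeepLowerAtThreeOffKatoStratum` (item 19679), registered
# stub `stub_nonAdditive`: the BRIDGE to cell `b2b-bsdres`'s level-lowering certificate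
# `LevelLowering.PlusSymbolLevelLowersOver` — «Tamagawa divisibility of deep Kurihara numbers» at
# exponent `1` from the certificate, and the certificate from the b2b cell's two typed inputs
# (MO) mod-`3` multiplicity one + (OLD) a non-zero `ℓ`-old eigensymbol

Cell `bsd-addord`, seat `bsd-addord-w2-acc2` (PROGRAMME PART 1b, ACCEL-LIST row (2)), gen 2; item
`stmt-BirchSwinnertonDyer-19679` (BC3 skeleton `DeepLowerAtThreeOffKatoStratum_birth.lean`, sha16
`e575d03075635394`; the owner w2-c2 assembles via `DeepLowerAtThreeOffKatoStratum_of`). DE-DUPLICATION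
(kim3 g3, cell STATUS l.132; this seat, STATUS 2026-08-26 «LANDED 1/2 … DE-DUP READING»): the owner's
level-lowering road `KimAtThreeDeepLowerTamagawaLevelLowering` (p457970/p458147/p459466: proper partial
Kurihara sums vanish, a `q`-stabilised symbol has zero Kurihara sums, displayed congruence (LL_m)) re-derives
cell `b2b-bsdres` seat additive-p4's lines V39–V44, in the tree as
`Summit.BirchSwinnertonDyer.Rank1Residual.LevelLowering.*` (`Rank1Residual/X4/KuriharaLevelLowering{,Fibres,
Descent,Field,OfMultiplicityOne}.lean`): the certificate `PlusSymbolLevelLowersAt W p f ℓ` / `…Over W p f ι ℓ`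
(a `1`-periodic `μ : ℚ → k`, `T_q`-eigen with eigenvalue `a_q(E)` at the Kolyvagin primes, with
`ι([r]⁺_f mod p) = μ(r) − μ(ℓ r)`), the kernel theorem `kuriharaSum_oldform_eq_zero` ⟹
`one_le_kuriharaPartialInfty_of_plusSymbolLevelLowersOver` (`∂^{(∞)}(δ̃) ≥ 1` at ANY `W`, `p` odd,
`E[p]` irreducible), and the provenance `plusSymbolLevelLowersOver_of_multiplicityOne`: certificate ⟸
(MO) `ModPMultiplicityOne k N θ̄_f` + (OLD) `HasOldEigenPlusSymb k N θ̄_f ℓ 1 μ` — typed PREDICATES with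
parameters, whose printed inputs are the tree's NAMED FACTS `ModularForms.wiles1995_multiplicityOne`
(Darmon–Diamond–Taylor Thm. 4.26 = Ribet 1990 Thm. 5.2 (b) / Mazur–Ribet / Wiles 1995 Thm. 2.1: `p ∤ N`, or
`p ∥ N` with `T_p ∉ 𝔪` — the latter is OUR multiplicative-`3` rows, `a₃ = ±1`), `ribet1984_iharaLemma`,
`diamond1995_refinedSerre`, modulo two standard dictionary nodes typed there
(`EichlerShimuraModPMultiplicityOneOfIrreducible`, with the `p = 3` rider «`9 ∣ N` or a prime `q ∣ N`
with `q ≡ 2 (mod 3)`» — no elliptic points of order `3` on `X₀(N)`, Ash–Stevens; and the level-`M` eigen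
datum of Ribet's form). This file connects THAT certificate to crux 19679's rows, so the W2 route's
«exactly one `3` in `∏ c_ℓ`» population and b2b's TAM-DEFECT₂ line consume ONE typed input.

What is here (theorems only, 0 def, no `sorry`, nothing asserted; the crux stays OPEN; BSD is not proved):
* §1 `tamagawa_le_kuriharaPartials_of_plusSymbolLevelLowersOver` — on a row with `v_p(∏ c_ℓ) ≤ 1` the b2b
  certificate at some `ℓ ∣ N_E` gives TamDiv∞ AND TamDiv-deep (`v_p(∏ c_ℓ) ≤ ∂^{(∞)} ≤ ∂^{(∞)}_{deep}`).
* §2 `plusSymbolLevelLowersOver_newform_of_multiplicityOne` — for the newform `D.f` of `W` at `N = N_E`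
  with `p`-integral plus symbols: (MO) + (OLD) + the `T_q`-relations of `μ` at the Kolyvagin primes ⟹ the
  certificate (b2b's `plusSymbolLevelLowersOver_of_multiplicityOne` with `θ = (a_n(E))_n`, `K_f = ℚ`,
  `Ω⁺_f > 0` and «Kolyvagin primes are good» discharged from the tree).
* §3 crux 19679 rows at `p = 3`: ★ `stub_nonAdditive_covered_of_plusSymbolLevelLowersOver` — the registered
  stub's binders VERBATIM, then «ordinary if good, (ram) if multiplicative», `v₃(∏ c_ℓ) ≤ 1` and a
  certificate at some `ℓ ∣ N` ⟹ the row (SIX named facts: `hYZ hW20 hSk hmod hGZK hM`); ★ its SEMISTABLE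
  form `stub_nonAdditive_semistable_of_plusSymbolLevelLowersOver` (no (ram), no Yan–Zhu; `hSk hmod hGZK hM
  hBCDT hLL`); ★★ `stub_nonAdditive_covered_of_multiplicityOne` / `…_semistable_of_multiplicityOne` — the
  same rows from (MO) + (OLD) directly. On these rows the owner's displayed (LL_1) is therefore REPLACED by
  b2b's finer typed inputs; rows with `v₃(∏ c_ℓ) ≥ 2`, the good-supersingular-`3` rows and the
  non-semistable multiplicative-`3` rows without (ram) are untouched (`KimAtThreeDeepLowerOffStratumResidue`).
[cite: Ribet1990, Thm. 1.1 and Thm. 5.2 (b)] [cite: DarmonDiamondTaylor1995, Thm. 4.26 (§4.5, p. 134)]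
[cite: Ribet1984ICM, Thm. 4.1] [cite: MazurTateTeitelbaum1986Invent, §I.4 (4.2) and §I.8]
[cite: Kim2022StructureSelmer, §1.4.3, §1.5.1, Conj. 1.10 (PDF pp. 7–8)] [cite: Kim2025RefinedTNC, §8.1.2]
[cite: KimKimSun2020Selecta, Rem. 2.3 and Thm. 7.5] [cite: Skinner2016PacificMC, Thm. C (§1)]
[cite: YanZhu2024MainConjNonCM, Thm. 4.15 (§4.6)] [cite: Mazur1978, Cor. 4.1] [cite: Miller2011LMS, Def. 1.1]
-/


set_option autoImplicit false
-- the Theorems namespace of a single-conjunct summit repeats the summit name by design (D-0017)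
set_option linter.dupNamespace false

noncomputable section

open scoped MatrixGroups ModularForm Classical

open CongruenceSubgroup WeierstrassCurve Literature.NumberTheory.EllipticCurves
  Literature.NumberTheory.EllipticCurves.ModularForms
  Literature.NumberTheory.EllipticCurves.Rank1Residual
  Literature.NumberTheory.EllipticCurves.Rank1Residual.Typed
  Literature.NumberTheory.EllipticCurves.Skinner2016
  Literature.NumberTheory.Automorphic
  Summit.BirchSwinnertonDyer.BirchSwinnertonDyer.Theorems.Rank1ResidualX1Defs

namespace Summit.BirchSwinnertonDyer.BirchSwinnertonDyer.Theorems.KimAtThreeDeepLowerOffStratumLevelLoweringBridge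

open Summit.BirchSwinnertonDyer.Rank1Residual
open Summit.BirchSwinnertonDyer.Rank1Residual.LevelLowering
open Summit.BirchSwinnertonDyer.BirchSwinnertonDyer.Theses.KimAtThreeKolyvagin
open Summit.BirchSwinnertonDyer.BirchSwinnertonDyer.Theorems.KimAtThreeDeepLowerSmallDefect
open Summit.BirchSwinnertonDyer.BirchSwinnertonDyer.Theorems.KimAtThreeDeepLowerNonAdditiveRows
open Summit.BirchSwinnertonDyer.BirchSwinnertonDyer.Theorems.KimAtThreeShallowEqDeepOffStratumNonAdditiveRows
open Summit.BirchSwinnertonDyer.BirchSwinnertonDyer.Theorems.KimAtThreeDeepLowerOffStratumSockets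
open Summit.BirchSwinnertonDyer.BirchSwinnertonDyer.Theorems.KimAtThreeDeepLowerOffStratumNonAdditiveRows
open Summit.BirchSwinnertonDyer.BirchSwinnertonDyer.Theorems.KimAtThreeDeepLowerTamagawaLevelLowering
open Summit.BirchSwinnertonDyer.BirchSwinnertonDyer.Theorems.KimAtThreeDeepLowerOffStratumSemistable

/-! ### §1 The certificate gives Tamagawa divisibility at exponent `1` (any odd `p`) -/

section Certificate

variable {k : Type*} [CommRing k] [Nontrivial k]
  (W : WeierstrassCurve ℚ) [W.IsElliptic] [W.IsGloballyMinimal] (p : ℕ) [Fact p.Prime]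

/-- **TamDiv∞ and TamDiv-deep at exponent `1` from the b2b certificate.** `p` odd, `E[p]` irreducible,
`D` a parametrisation datum at `N = N_E`; if the mod-`p` plus symbol of `D.f` level-lowers over some residue
ring `k` at some `ℓ ∣ N_E` (`PlusSymbolLevelLowersOver W p D.f ι ℓ`, cell b2b-bsdres) and `v_p(∏ c_ℓ) ≤ 1`,
then `v_p(∏ c_ℓ) ≤ ∂^{(∞)}(δ̃) ≤ ∂^{(∞)}_{deep}(δ̃)` — the displayed Tamagawa-divisibility binders of the W2
sockets, discharged on the «exactly one `p` in `∏ c_ℓ`» rows. [cite: Kim2022StructureSelmer, §1.5.1 (PDF p. 7), Conj. 1.10 (PDF p. 8)]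
[cite: Ribet1990, Thm. 1.1 and Thm. 5.2 (b)] -/
theorem tamagawa_le_kuriharaPartials_of_plusSymbolLevelLowersOver (hp2 : p ≠ 2)
    (hirr : W.HasIrreducibleModPGaloisRep p) {N : ℕ} [NeZero N] (D : ModularParametrizationData W N)
    (hN : W.conductorNorm ℤ = N) {ι : ZMod p →+* k} {ℓ : ℕ}
    (hcert : PlusSymbolLevelLowersOver W p D.f ι ℓ) (hℓ : ℓ ∣ W.conductorNorm ℤ)
    (hv : padicValNat p W.tamagawaProduct ≤ 1) :
    ((padicValNat p W.tamagawaProduct : ℕ) : ℕ∞) ≤ kuriharaPartialInfty W p D.f ∧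
      ((padicValNat p W.tamagawaProduct : ℕ) : ℕ∞) ≤ kuriharaPartialDeepInfty W p D.f := by
  have h1 : (1 : ℕ∞) ≤ kuriharaPartialInfty W p D.f :=
    one_le_kuriharaPartialInfty_of_plusSymbolLevelLowersOver W p hp2 hirr D hN hcert hℓ
  have hv' : ((padicValNat p W.tamagawaProduct : ℕ) : ℕ∞) ≤ (1 : ℕ∞) := by exact_mod_cast hv
  exact ⟨hv'.trans h1, (hv'.trans h1).trans (kuriharaPartialInfty_le_kuriharaPartialDeepInfty W p D.f)⟩

end Certificate

/-! ### §2 The certificate for the newform of `W` from (MO) + (OLD) -/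

section Provenance

variable {k : Type*} [CommRing k]
  (W : WeierstrassCurve ℚ) [W.IsElliptic] [W.IsGloballyMinimal] (p : ℕ) [Fact p.Prime]

/-- **The b2b certificate for the newform `D.f` of `W` from the two typed inputs.** `D` a parametrisation
datum (any level `N`; the plus symbols `p`-integral, crux binder shape); (MO) mod-`p` multiplicity one for the
`θ̄`-eigen plus symbols of level `N`, `θ = (a_n(E))_n` (`W.LFunction`; in print for `p ∤ 2N` and `ρ̄`
irreducible — DDT Thm. 4.26 / `wiles1995_multiplicityOne` + the Eichler–Shimura dictionary node); (OLD) a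
NON-ZERO `ℓ`-old eigen-plus symbol `r ↦ μ(r) − μ(ℓ r)` with `μ` `1`-periodic and `T_q`-eigen at the Kolyvagin
primes (in print when `ρ̄` is unramified at `ℓ ∥ N`, `a_ℓ = 1`: Ribet 1990 Thm. 1.1 + Ihara); then
`PlusSymbolLevelLowersOver W p D.f ι ℓ`. The newform data of b2b's `plusSymbolLevelLowersOver_of_multiplicityOne`
(`IsNewform0`, `K_f = ℚ`, `Ω⁺_f ≠ 0`, `θ(q) = a_q(f)`, «Kolyvagin primes are good, `a_q(E) = a_q(f)`») are
DISCHARGED from the tree. [cite: Ribet1990, Thm. 1.1 and Thm. 5.2 (b)] [cite: DarmonDiamondTaylor1995, Thm. 4.26 (§4.5, p. 134)]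
[cite: Ribet1984ICM, Thm. 4.1] [cite: MazurTateTeitelbaum1986Invent, §I.4 (4.2) and §I.8] -/
theorem plusSymbolLevelLowersOver_newform_of_multiplicityOne {N : ℕ} [NeZero N]
    (D : ModularParametrizationData W N)
    (hint : ∀ r : ℚ, ratPlusSymbol D.f r ≠ 0 → 0 ≤ padicValRat p (ratPlusSymbol D.f r))
    (ι : ZMod p →+* k)
    (hMO : ModPMultiplicityOne k N (fun q ↦ ι ((W.LFunction q : ℤ) : ZMod p)))
    {ℓ : ℕ} {μ : ℚ → k}
    (hOLD : HasOldEigenPlusSymb k N (fun q ↦ ι ((W.LFunction q : ℤ) : ZMod p)) ℓ 1 μ)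
    (hμ : IsPeriodic μ)
    (hH : ∀ q : ℕ, Kato.IsKolyvaginPrime W p 1 q → HeckeRel μ q (ι (W.frobeniusTrace q : ZMod p))) :
    PlusSymbolLevelLowersOver W p D.f ι ℓ := by
  have hf : IsNewformOf W D.f := D.isNewformOf
  have hΩ : plusPeriod D.f ≠ 0 := (IsNewform0.plusPeriod_pos_holds hf.1 hf.coeffField_eq_bot).ne'
  have hgoodq : ∀ q : ℕ, Kato.IsKolyvaginPrime W p 1 q →
      (W.frobeniusTrace q : ZMod p) = ((W.LFunction q : ℤ) : ZMod p) := by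
    intro q hq
    haveI : Fact q.Prime := ⟨hq.prime⟩
    rw [W.LFunction_apply_prime_eq_frobeniusTrace q
      (hasGoodReductionAtPrime_of_not_dvd_conductorNorm W hq.not_dvd_conductorNorm)]
  refine plusSymbolLevelLowersOver_of_multiplicityOne (ι := ι) W hf.1 hf.coeffField_eq_bot hΩ
    (not_dvd_den_of_padicValRat_nonneg p D.f hint) (fun q ↦ (W.LFunction q : ℤ))
    (fun q _ ↦ (hf.2 q).symm) hgoodq hMO hOLD hμ (fun q hq ↦ ?_)
  rw [← hgoodq q hq]
  exact hH q hq

end Provenance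

/-! ### §3 Crux 19679 `DeepLowerAtThreeOffKatoStratum` at `p = 3`: rows from the certificate / from (MO)+(OLD) -/

section Rows

variable {k : Type*} [CommRing k] [Nontrivial k]

/-- ★ **`stub_nonAdditive` on its COVERED rows with `v₃(∏ c_ℓ) ≤ 1` from the b2b certificate** — binders
of the registered stub VERBATIM, then «ordinary if good, (ram) if multiplicative», `v₃(∏ c_ℓ) ≤ 1`, and a
level-lowering certificate over some residue ring `k` at some `ℓ ∣ N` (cell b2b-bsdres'
`PlusSymbolLevelLowersOver W₀ 3 D₀.f ι ℓ`). SIX named facts (`hYZ hW20 hSk hmod hGZK hM`); (TD) at exponent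
`1` is §1. [cite: YanZhu2024MainConjNonCM, Thm. 4.15 (§4.6)] [cite: Skinner2016PacificMC, Thm. C (§1)]
[cite: Mazur1978, Cor. 4.1] [cite: Ribet1990, Thm. 1.1 and Thm. 5.2 (b)] [cite: Kim2022StructureSelmer, Conj. 1.10 (PDF p. 8)] -/
theorem stub_nonAdditive_covered_of_plusSymbolLevelLowersOver
    (hYZ : YanZhu2026.thm415_padicValRat_bsd_rank_le_one)
    (hW20 : Wuthrich2014.lemma20_surjective_threeAdic_of_semistable)
    (hSk : Skinner2016.thmC_padicValRat_bsd_rank_zero)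
    (hmod : hasEntireLFunction_rat) (hGZK : rank_eq_analyticRank_of_analyticRank_le_one)
    (hM : mazur_not_dvd_maninConstant_of_odd) :
    ∀ (W₀ : WeierstrassCurve ℚ) [W₀.IsElliptic] [W₀.IsGloballyMinimal],
      (∀ n : ℕ, W₀.HasSurjectiveModNGaloisRep (3 ^ n : ℕ)) → Finite W₀.sha →
      ∀ {N : ℕ} [NeZero N], N = W₀.conductorNorm ℤ →
      ∀ (D₀ : ModularParametrizationData W₀ N),
        (∀ z ∈ D₀.L.lattice, ∃ w ∈ periodLattice D₀.f, z = D₀.c * w) →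
        (∀ (W₂ : WeierstrassCurve ℚ) [W₂.IsElliptic] (D₂ : ModularParametrizationData W₂ N),
          D₂.f = D₀.f → D₀.modularDegree ≤ D₂.modularDegree) →
        (∀ r : ℚ, ratPlusSymbol D₀.f r ≠ 0 → 0 ≤ padicValRat 3 (ratPlusSymbol D₀.f r)) →
        kuriharaVanishingOrder W₀ 3 D₀.f = 0 →
        ¬ (haveI : Fact (Nat.Prime 3) := ⟨Nat.prime_three⟩; Addv W₀ 3) →
        (W₀.HasGoodReductionAtPrime 3 → ¬ (3 : ℤ) ∣ W₀.frobeniusTrace 3) →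
        (W₀.HasMultiplicativeReductionAtPrime 3 →
          (haveI : Fact (Nat.Prime 3) := ⟨Nat.prime_three⟩; Ram W₀ 3)) →
        padicValNat 3 W₀.tamagawaProduct ≤ 1 →
        ∀ (ι : ZMod 3 →+* k) (ℓ : ℕ), ℓ ∣ W₀.conductorNorm ℤ →
          (haveI : Fact (Nat.Prime 3) := ⟨Nat.prime_three⟩; PlusSymbolLevelLowersOver W₀ 3 D₀.f ι ℓ) →
        ∃ d : ℕ, kuriharaPartialDeepInfty W₀ 3 D₀.f = d ∧
          kuriharaPartial W₀ 3 D₀.f 0 ≤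
            ((padicValNat 3 (Nat.card (AddCommGroup.primaryComponent W₀.sha 3)) + d : ℕ) : ℕ∞) := by
  intro W₀ _ _ htower hfin N _ hN D₀ hopt hdeg hint hord hnA hordinary hram hv ι ℓ hℓ hcert
  haveI : Fact (Nat.Prime 3) := ⟨Nat.prime_three⟩
  have hirr : W₀.HasIrreducibleModPGaloisRep 3 :=
    hasIrreducibleModPGaloisRep_of_hasSurjectiveModNGaloisRep W₀ 3 (by simpa using htower 1)
  exact stub_nonAdditive_covered_of_tamagawa_le_deepInfty hYZ hW20 hSk hmod hGZK hM W₀ htower hfin hN D₀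
    hopt hdeg hint hord hnA hordinary hram (fun _ =>
      (tamagawa_le_kuriharaPartials_of_plusSymbolLevelLowersOver W₀ 3 (by norm_num) hirr D₀ hN.symm hcert
        hℓ hv).2)

/-- ★ **The same on the SEMISTABLE rows — no (ram), no Yan–Zhu binder**: stub binders verbatim, then
`Semistable W₀`, «ordinary if good», `v₃(∏ c_ℓ) ≤ 1`, the certificate at some `ℓ ∣ N`; named facts
`hSk hmod hGZK hM hBCDT hLL` (§2 of `KimAtThreeDeepLowerOffStratumSemistable`). [cite: Skinner2016PacificMC, Thm. C (§1)]
[cite: Ribet1990, Thm. 1.1] [cite: Mazur1978, Cor. 4.1] [cite: Kim2022StructureSelmer, Conj. 1.10 (PDF p. 8)] -/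
theorem stub_nonAdditive_semistable_of_plusSymbolLevelLowersOver
    (hSk : Skinner2016.thmC_padicValRat_bsd_rank_zero)
    (hmod : hasEntireLFunction_rat) (hGZK : rank_eq_analyticRank_of_analyticRank_le_one)
    (hM : mazur_not_dvd_maninConstant_of_odd)
    (hBCDT : exists_isNewformOf) (hLL : diamond1995_refinedSerre) :
    ∀ (W₀ : WeierstrassCurve ℚ) [W₀.IsElliptic] [W₀.IsGloballyMinimal],
      (∀ n : ℕ, W₀.HasSurjectiveModNGaloisRep (3 ^ n : ℕ)) → Finite W₀.sha →
      ∀ {N : ℕ} [NeZero N], N = W₀.conductorNorm ℤ →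
      ∀ (D₀ : ModularParametrizationData W₀ N),
        (∀ z ∈ D₀.L.lattice, ∃ w ∈ periodLattice D₀.f, z = D₀.c * w) →
        (∀ (W₂ : WeierstrassCurve ℚ) [W₂.IsElliptic] (D₂ : ModularParametrizationData W₂ N),
          D₂.f = D₀.f → D₀.modularDegree ≤ D₂.modularDegree) →
        (∀ r : ℚ, ratPlusSymbol D₀.f r ≠ 0 → 0 ≤ padicValRat 3 (ratPlusSymbol D₀.f r)) →
        kuriharaVanishingOrder W₀ 3 D₀.f = 0 →
        ¬ (haveI : Fact (Nat.Prime 3) := ⟨Nat.prime_three⟩; Addv W₀ 3) →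
        Semistable W₀ →
        (W₀.HasGoodReductionAtPrime 3 → ¬ (3 : ℤ) ∣ W₀.frobeniusTrace 3) →
        padicValNat 3 W₀.tamagawaProduct ≤ 1 →
        ∀ (ι : ZMod 3 →+* k) (ℓ : ℕ), ℓ ∣ W₀.conductorNorm ℤ →
          (haveI : Fact (Nat.Prime 3) := ⟨Nat.prime_three⟩; PlusSymbolLevelLowersOver W₀ 3 D₀.f ι ℓ) →
        ∃ d : ℕ, kuriharaPartialDeepInfty W₀ 3 D₀.f = d ∧
          kuriharaPartial W₀ 3 D₀.f 0 ≤
            ((padicValNat 3 (Nat.card (AddCommGroup.primaryComponent W₀.sha 3)) + d : ℕ) : ℕ∞) := by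
  intro W₀ _ _ htower hfin N _ hN D₀ hopt hdeg hint hord hnA hsst hordinary hv ι ℓ hℓ hcert
  haveI : Fact (Nat.Prime 3) := ⟨Nat.prime_three⟩
  have hirr : W₀.HasIrreducibleModPGaloisRep 3 :=
    hasIrreducibleModPGaloisRep_of_hasSurjectiveModNGaloisRep W₀ 3 (by simpa using htower 1)
  exact stub_nonAdditive_semistable_of_skinner_of_tamagawa_le_deepInfty hSk hmod hGZK hM hBCDT hLL W₀ htower
    hfin hN D₀ hopt hdeg hint hord hnA hsst hordinary (fun _ =>
      (tamagawa_le_kuriharaPartials_of_plusSymbolLevelLowersOver W₀ 3 (by norm_num) hirr D₀ hN.symm hcert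
        hℓ hv).2)

/-- ★★ **`stub_nonAdditive` on its COVERED rows with `v₃(∏ c_ℓ) ≤ 1` from (MO) + (OLD)** — binders verbatim,
then «ordinary if good, (ram) if multiplicative», `v₃(∏ c_ℓ) ≤ 1`, a prime-or-not `ℓ ∣ N`, and cell
b2b-bsdres' two typed inputs at level `N` read in a residue ring `k` along `ι : 𝔽₃ → k`: (MO)
`ModPMultiplicityOne k N θ̄_E` and (OLD) `HasOldEigenPlusSymb k N θ̄_E ℓ 1 μ` with `μ` `1`-periodic and
`T_q`-eigen (`a_q(E)`) at the Kolyvagin primes. SIX named facts. This is the form in which the owner's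
displayed (LL_1) should be carried: b2b's (MO) rests on the NAMED FACT `wiles1995_multiplicityOne` plus an
Eichler–Shimura dictionary node (with the `p = 3` rider «a prime `q ≡ 2 (mod 3)` divides `N`», since
`9 ∤ N` here), (OLD) on `diamond1995_refinedSerre` + `ribet1984_iharaLemma` plus the level-`N/ℓ` eigen datum.
[cite: DarmonDiamondTaylor1995, Thm. 4.26 (§4.5, p. 134)] [cite: Ribet1990, Thm. 1.1 and Thm. 5.2 (b)]
[cite: Ribet1984ICM, Thm. 4.1] [cite: YanZhu2024MainConjNonCM, Thm. 4.15 (§4.6)] [cite: Skinner2016PacificMC, Thm. C (§1)]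
[cite: Mazur1978, Cor. 4.1] [cite: Kim2022StructureSelmer, Conj. 1.10 (PDF p. 8)] -/
theorem stub_nonAdditive_covered_of_multiplicityOne
    (hYZ : YanZhu2026.thm415_padicValRat_bsd_rank_le_one)
    (hW20 : Wuthrich2014.lemma20_surjective_threeAdic_of_semistable)
    (hSk : Skinner2016.thmC_padicValRat_bsd_rank_zero)
    (hmod : hasEntireLFunction_rat) (hGZK : rank_eq_analyticRank_of_analyticRank_le_one)
    (hM : mazur_not_dvd_maninConstant_of_odd) :
    ∀ (W₀ : WeierstrassCurve ℚ) [W₀.IsElliptic] [W₀.IsGloballyMinimal],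
      (∀ n : ℕ, W₀.HasSurjectiveModNGaloisRep (3 ^ n : ℕ)) → Finite W₀.sha →
      ∀ {N : ℕ} [NeZero N], N = W₀.conductorNorm ℤ →
      ∀ (D₀ : ModularParametrizationData W₀ N),
        (∀ z ∈ D₀.L.lattice, ∃ w ∈ periodLattice D₀.f, z = D₀.c * w) →
        (∀ (W₂ : WeierstrassCurve ℚ) [W₂.IsElliptic] (D₂ : ModularParametrizationData W₂ N),
          D₂.f = D₀.f → D₀.modularDegree ≤ D₂.modularDegree) →
        (∀ r : ℚ, ratPlusSymbol D₀.f r ≠ 0 → 0 ≤ padicValRat 3 (ratPlusSymbol D₀.f r)) →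
        kuriharaVanishingOrder W₀ 3 D₀.f = 0 →
        ¬ (haveI : Fact (Nat.Prime 3) := ⟨Nat.prime_three⟩; Addv W₀ 3) →
        (W₀.HasGoodReductionAtPrime 3 → ¬ (3 : ℤ) ∣ W₀.frobeniusTrace 3) →
        (W₀.HasMultiplicativeReductionAtPrime 3 →
          (haveI : Fact (Nat.Prime 3) := ⟨Nat.prime_three⟩; Ram W₀ 3)) →
        padicValNat 3 W₀.tamagawaProduct ≤ 1 →
        ∀ (ι : ZMod 3 →+* k) (ℓ : ℕ), ℓ ∣ W₀.conductorNorm ℤ →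
          ModPMultiplicityOne k N (fun q ↦ ι ((W₀.LFunction q : ℤ) : ZMod 3)) →
          ∀ (μ : ℚ → k), HasOldEigenPlusSymb k N (fun q ↦ ι ((W₀.LFunction q : ℤ) : ZMod 3)) ℓ 1 μ →
          IsPeriodic μ →
          (∀ q : ℕ, (haveI : Fact (Nat.Prime 3) := ⟨Nat.prime_three⟩; Kato.IsKolyvaginPrime W₀ 3 1 q) →
            HeckeRel μ q (ι (W₀.frobeniusTrace q : ZMod 3))) →
        ∃ d : ℕ, kuriharaPartialDeepInfty W₀ 3 D₀.f = d ∧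
          kuriharaPartial W₀ 3 D₀.f 0 ≤
            ((padicValNat 3 (Nat.card (AddCommGroup.primaryComponent W₀.sha 3)) + d : ℕ) : ℕ∞) := by
  intro W₀ _ _ htower hfin N _ hN D₀ hopt hdeg hint hord hnA hordinary hram hv ι ℓ hℓ hMO μ hOLD hμ hH
  haveI : Fact (Nat.Prime 3) := ⟨Nat.prime_three⟩
  exact stub_nonAdditive_covered_of_plusSymbolLevelLowersOver hYZ hW20 hSk hmod hGZK hM W₀ htower hfin hN
    D₀ hopt hdeg hint hord hnA hordinary hram hv ι ℓ hℓ
    (plusSymbolLevelLowersOver_newform_of_multiplicityOne W₀ 3 D₀ hint ι hMO hOLD hμ hH)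

/-- ★★ **The same on the SEMISTABLE rows** (no (ram), no Yan–Zhu; `hSk hmod hGZK hM hBCDT hLL` + (MO) + (OLD)).
On a semistable row DDT Thm. 4.26 applies at `p = 3` in BOTH its clauses (`3 ∤ N`, or `3 ∥ N` with
`U₃ = a₃ = ±1 ∉ 𝔪`). [cite: DarmonDiamondTaylor1995, Thm. 4.26 (§4.5, p. 134)] [cite: Ribet1990, Thm. 1.1 and Thm. 5.2 (b)]
[cite: Skinner2016PacificMC, Thm. C (§1)] [cite: Mazur1978, Cor. 4.1] [cite: Kim2022StructureSelmer, Conj. 1.10 (PDF p. 8)] -/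
theorem stub_nonAdditive_semistable_of_multiplicityOne
    (hSk : Skinner2016.thmC_padicValRat_bsd_rank_zero)
    (hmod : hasEntireLFunction_rat) (hGZK : rank_eq_analyticRank_of_analyticRank_le_one)
    (hM : mazur_not_dvd_maninConstant_of_odd)
    (hBCDT : exists_isNewformOf) (hLL : diamond1995_refinedSerre) :
    ∀ (W₀ : WeierstrassCurve ℚ) [W₀.IsElliptic] [W₀.IsGloballyMinimal],
      (∀ n : ℕ, W₀.HasSurjectiveModNGaloisRep (3 ^ n : ℕ)) → Finite W₀.sha →
      ∀ {N : ℕ} [NeZero N], N = W₀.conductorNorm ℤ →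
      ∀ (D₀ : ModularParametrizationData W₀ N),
        (∀ z ∈ D₀.L.lattice, ∃ w ∈ periodLattice D₀.f, z = D₀.c * w) →
        (∀ (W₂ : WeierstrassCurve ℚ) [W₂.IsElliptic] (D₂ : ModularParametrizationData W₂ N),
          D₂.f = D₀.f → D₀.modularDegree ≤ D₂.modularDegree) →
        (∀ r : ℚ, ratPlusSymbol D₀.f r ≠ 0 → 0 ≤ padicValRat 3 (ratPlusSymbol D₀.f r)) →
        kuriharaVanishingOrder W₀ 3 D₀.f = 0 →
        ¬ (haveI : Fact (Nat.Prime 3) := ⟨Nat.prime_three⟩; Addv W₀ 3) →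
        Semistable W₀ →
        (W₀.HasGoodReductionAtPrime 3 → ¬ (3 : ℤ) ∣ W₀.frobeniusTrace 3) →
        padicValNat 3 W₀.tamagawaProduct ≤ 1 →
        ∀ (ι : ZMod 3 →+* k) (ℓ : ℕ), ℓ ∣ W₀.conductorNorm ℤ →
          ModPMultiplicityOne k N (fun q ↦ ι ((W₀.LFunction q : ℤ) : ZMod 3)) →
          ∀ (μ : ℚ → k), HasOldEigenPlusSymb k N (fun q ↦ ι ((W₀.LFunction q : ℤ) : ZMod 3)) ℓ 1 μ →
          IsPeriodic μ →
          (∀ q : ℕ, (haveI : Fact (Nat.Prime 3) := ⟨Nat.prime_three⟩; Kato.IsKolyvaginPrime W₀ 3 1 q) →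
            HeckeRel μ q (ι (W₀.frobeniusTrace q : ZMod 3))) →
        ∃ d : ℕ, kuriharaPartialDeepInfty W₀ 3 D₀.f = d ∧
          kuriharaPartial W₀ 3 D₀.f 0 ≤
            ((padicValNat 3 (Nat.card (AddCommGroup.primaryComponent W₀.sha 3)) + d : ℕ) : ℕ∞) := by
  intro W₀ _ _ htower hfin N _ hN D₀ hopt hdeg hint hord hnA hsst hordinary hv ι ℓ hℓ hMO μ hOLD hμ hH
  haveI : Fact (Nat.Prime 3) := ⟨Nat.prime_three⟩
  exact stub_nonAdditive_semistable_of_plusSymbolLevelLowersOver hSk hmod hGZK hM hBCDT hLL W₀ htower hfin hN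
    D₀ hopt hdeg hint hord hnA hsst hordinary hv ι ℓ hℓ
    (plusSymbolLevelLowersOver_newform_of_multiplicityOne W₀ 3 D₀ hint ι hMO hOLD hμ hH)

end Rows

end Summit.BirchSwinnertonDyer.BirchSwinnertonDyer.Theorems.KimAtThreeDeepLowerOffStratumLevelLoweringBridge

end
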